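import Literature.NumberTheory.EllipticCurves.SupersingularDensitySerreLadicProofs
import Literature.NumberTheory.EllipticCurves.TateModuleDeterminantProofs
import HarnessLib

/-!
# Density `0` of the supersingular primes (Serre) — proofs, part 11: scalar commutators in
# `ρ_{E,ℓ}(Gal(ℚ̄/ℚ(E[ℓⁿ])))` are trivial; the `ℓ`-adic route in "non-abelian" form

Eleventh `…Proofs` file (theorems only, nothing is defined, no named fact) of the series on
`WeierstrassCurve.serre_supersingular_density_zero` (Serre 1981, §8 Thm. 20 Cor. 2; p. 123 (a);
Serre 1968, IV-13 Exercise 1).  Part 10 (`SupersingularDensitySerreLadicProofs`) proved the fact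
for every curve `E/ℚ` admitting a prime `ℓ` such that, for every `n`, some commutator of two
elements of `V_n = Gal(ℚ̄/ℚ(E[ℓⁿ]))` is not an integer scalar on some `E[ℓᵐ]`.  Here that
hypothesis is put in its classical form **"`ρ_{E,ℓ}(V_n)` is non-abelian for every `n`"**
(`ρ_{E,ℓ}` the `ℓ`-adic representation on the Tate module `T_ℓ E`), for odd `ℓ`:

* `WeierstrassCurve.pow_dvd_sub_one_of_det_eq_one_of_forall_smul_eq` — if `w ∈ Γ_K` has
  `det ρ_ℓ(w) = 1`, acts trivially on `E[ℓ]` and as the integer `c` on `E[ℓᵏ]`, then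
  `ℓᵏ ∣ c - 1` (`ℓ` odd): in a `ℤ_ℓ`-basis of `T_ℓ E` reduced to `E[ℓᵏ]` (a `ℤ/ℓᵏ`-basis, the
  projection being onto and `#E[ℓᵏ] = ℓ²ᵏ`) the matrix of `w` is `≡ c · 1`, so `c² ≡ det = 1`,
  and `c ≡ 1 (mod ℓ)` singles out the root `c ≡ 1 (mod ℓᵏ)`;
* `WeierstrassCurve.exists_commutator_not_scalar_of_galoisRepTate_mul_ne` — hence if
  `σ, τ ∈ V_n` (`n ≥ 1`) have `ρ_ℓ(σ)ρ_ℓ(τ) ≠ ρ_ℓ(τ)ρ_ℓ(σ)`, their commutator is not a scalar on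
  some `E[ℓᵐ]` (a commutator has determinant `1`; were it scalar at every level it would be
  trivial at every level, i.e. trivial on `T_ℓ E = lim E[ℓᵏ]`);
* `WeierstrassCurve.hasPrimeDensity_goodSupersingularPrimes_zero_of_galoisRepTate_mul_ne` and
  `WeierstrassCurve.serre_supersingular_density_zero_of_galoisRepTate_mul_ne` — **density `0` of
  the supersingular primes of every `E/ℚ` for which some odd `ℓ` has `ρ_{E,ℓ}(V_n)` non-abelian
  for all `n`**, and the named fact `serre_supersingular_density_zero` granted this for every
  non-CM curve (Serre 1968, IV.2.2: for a non-CM curve `𝔤_ℓ = 𝔤𝔩₂`, so no open subgroup of the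
  image is abelian; in the tree this is the content of the residual Faltings fact
  `Literature.AlgebraicGeometry.Motives.exists_eq_smul_one_of_equivariant_of_not_hasRationalCM`
  over the number fields `ℚ(E[ℓⁿ])`, combined with the tree's theorem
  `finrank_ne_one_of_stable_of_not_hasRationalCM_of_isogenyClass`).

## References

* [Serre1981] J.-P. Serre, Publ. Math. IHÉS 54 (1981): p. 123 (a), §8 Thm. 20, Cor. 2.
* [Serre1968] J.-P. Serre, *Abelian ℓ-adic representations and elliptic curves* (1968), IV-13
  Exercise 1, IV.2.2.
* [SilvermanAEC2009] J. H. Silverman, *The Arithmetic of Elliptic Curves*, 2nd ed., III.§7,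
  Cor. III.6.4, Prop. III.7.1.
-/

noncomputable section

open scoped Classical NumberField
open IsDedekindDomain Field Filter

namespace WeierstrassCurve

open Literature.NumberTheory.EllipticCurves Literature.NumberTheory.GaloisRepresentations
  Literature.NumberTheory.LFunctions NumberField Rat.HeightOneSpectrum

/-! ### Scalar elements of determinant `1` -/

section AnyField

variable {K : Type*} [Field K] (W : WeierstrassCurve K) (ℓ : ℕ) [Fact ℓ.Prime]

/-- For `Q ∈ E[N]` and `z : ℤ`: `(z mod N) • Q = z • Q`. [folklore] -/
theorem val_intCast_smul_geomTorsion {N : ℕ} [NeZero N] (Q : geomTorsion W (N : ℤ)) (z : ℤ) :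
    ((z : ZMod N).val : ℤ) • Q = z • Q := by
  have hN : (N : ℤ) • Q = 0 := by
    apply Subtype.ext
    rw [AddSubgroupClass.coe_zsmul, ZeroMemClass.coe_zero]
    exact (Submodule.mem_torsionBy_iff (N : ℤ) (Q : geomPoints W)).mp Q.2
  rw [ZMod.val_intCast, ← sub_eq_zero, ← sub_smul, Int.emod_def, sub_sub_cancel_left, neg_smul,
    neg_eq_zero, mul_comm, mul_smul, hN, smul_zero]

/-- **A determinant-one element acting on `E[ℓᵏ]` as an integer `c`, trivially on `E[ℓ]`, has
`c ≡ 1 (mod ℓᵏ)`** (`ℓ` odd, `ℓ ≠ char K`).  In the `ℤ/ℓᵏ`-basis of `E[ℓᵏ]` obtained by reducing a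
`ℤ_ℓ`-basis of `T_ℓ E` (the reduction is onto, `proj_surjective_of_isAlgClosed_holds`, and
`#E[ℓᵏ] = ℓ²ᵏ`, Silverman Cor. III.6.4, so the two reduced vectors are independent) the matrix of
`w` is congruent to `c · 1`, whence `c² ≡ det ρ_ℓ(w) = 1 (mod ℓᵏ)`; as `c ≡ 1 (mod ℓ)` (a basis
vector reduces to a point of order `ℓ`, `proj_one_basis_ne_zero`) and `ℓ` is odd, `ℓᵏ` is coprime
to `c + 1` and divides `c - 1`. [cite: SilvermanAEC2009, III.§7 with Cor. III.6.4] -/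
theorem pow_dvd_sub_one_of_det_eq_one_of_forall_smul_eq [W.IsElliptic] (hℓK : (ℓ : K) ≠ 0)
    (hℓ2 : ℓ ≠ 2) {k : ℕ} {w : absoluteGaloisGroup K} {c : ℤ}
    (hdet : LinearMap.det (W.galoisRepTate ℓ w : W.tateModule ℓ →ₗ[ℤ_[ℓ]] W.tateModule ℓ) = 1)
    (h1 : ∀ P : geomTorsion W ((ℓ ^ 1 : ℕ) : ℤ), w • P = P)
    (hc : ∀ P : geomTorsion W ((ℓ ^ k : ℕ) : ℤ), w • P = c • P) :
    ((ℓ ^ k : ℕ) : ℤ) ∣ c - 1 := by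
  have hℓ : ℓ.Prime := Fact.out
  rcases Nat.eq_zero_or_pos k with rfl | hkpos
  · rw [pow_zero, Nat.cast_one]
    exact one_dvd _
  haveI := module_free_tateModule_holds W ℓ
  haveI := module_finite_tateModule_holds W ℓ
  let b := Module.finBasisOfFinrankEq ℤ_[ℓ] (W.tateModule ℓ) (finrank_tateModule_eq_two_holds W ℓ hℓK)
  haveI : NeZero (ℓ ^ k) := ⟨pow_ne_zero _ hℓ.ne_zero⟩
  have hNint : (((ℓ ^ k : ℕ) : ℤ)) ≠ 0 := by exact_mod_cast pow_ne_zero k hℓ.ne_zero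
  haveI : Finite (geomTorsion W ((ℓ ^ k : ℕ) : ℤ)) :=
    finite_torsionPoints_holds W (AlgebraicClosure K) hNint
  -- (i) `ℓ ∣ c - 1`: the basis vector `b 0` reduces to a point `P₁ ∈ E[ℓ]` of order `ℓ`
  have hℓdvd : (ℓ : ℤ) ∣ c - 1 := by
    have hmem1 : TateModule.proj ℓ 1 (b 0) ∈ geomTorsion W ((ℓ ^ 1 : ℕ) : ℤ) :=
      proj_tateModule_mem_geomTorsion W ℓ 1 (b 0)
    have hmemk : TateModule.proj ℓ 1 (b 0) ∈ geomTorsion W ((ℓ ^ k : ℕ) : ℤ) := by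
      have h11 : ((ℓ ^ 1 : ℕ) : ℤ) ∣ ((ℓ ^ k : ℕ) : ℤ) := by exact_mod_cast pow_dvd_pow ℓ hkpos
      obtain ⟨d, hd⟩ := h11
      have h := (Submodule.mem_torsionBy_iff _ _).mp hmem1
      show TateModule.proj ℓ 1 (b 0) ∈ Submodule.torsionBy ℤ (geomPoints W) (((ℓ ^ k : ℕ) : ℤ))
      rw [Submodule.mem_torsionBy_iff, hd, mul_comm, mul_smul, h, smul_zero]
    have hw1 := congrArg (fun Q : geomTorsion W ((ℓ ^ 1 : ℕ) : ℤ) ↦ (Q : geomPoints W))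
      (h1 ⟨_, hmem1⟩)
    have hwk := congrArg (fun Q : geomTorsion W ((ℓ ^ k : ℕ) : ℤ) ↦ (Q : geomPoints W))
      (hc ⟨_, hmemk⟩)
    simp only [AddSubgroup.torsionBy.coe_smul] at hw1 hwk
    rw [hw1] at hwk
    have hP1 : TateModule.proj ℓ 1 (b 0) ≠ 0 := proj_one_basis_ne_zero W ℓ b 0
    have hord : addOrderOf (TateModule.proj ℓ 1 (b 0)) = ℓ := by
      refine addOrderOf_eq_prime ?_ hP1
      have h := (Submodule.mem_torsionBy_iff _ _).mp hmem1
      rw [pow_one, natCast_zsmul] at h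
      exact h
    have hzero : (c - 1) • TateModule.proj ℓ 1 (b 0) = 0 := by
      rw [sub_smul, one_smul, ← hwk, sub_self]
    have h := addOrderOf_dvd_iff_zsmul_eq_zero.mpr hzero
    rwa [hord] at h
  -- (ii) `ℓᵏ ∣ c² - 1`: the matrix of `w` reduces to `c · 1` in the reduced basis of `E[ℓᵏ]`
  have hsqdvd : (((ℓ ^ k : ℕ) : ℤ)) ∣ c ^ 2 - 1 := by
    have hmem : ∀ i, TateModule.proj ℓ k (b i) ∈ geomTorsion W ((ℓ ^ k : ℕ) : ℤ) := fun i ↦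
      proj_tateModule_mem_geomTorsion W ℓ k (b i)
    set e : Fin 2 → geomTorsion W ((ℓ ^ k : ℕ) : ℤ) := fun i ↦ ⟨TateModule.proj ℓ k (b i), hmem i⟩
      with he
    set g : ZMod (ℓ ^ k) × ZMod (ℓ ^ k) → geomTorsion W ((ℓ ^ k : ℕ) : ℤ) :=
      fun xy ↦ xy.1.val • e 0 + xy.2.val • e 1 with hg
    have hgcoe : ∀ xy : ZMod (ℓ ^ k) × ZMod (ℓ ^ k), (g xy : geomPoints W) =
        xy.1.val • TateModule.proj ℓ k (b 0) + xy.2.val • TateModule.proj ℓ k (b 1) := fun xy ↦ by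
      rw [hg]
      simp only [AddSubgroup.coe_add, AddSubgroupClass.coe_nsmul, he]
    -- `g` is onto (the projection `T_ℓ E → E[ℓᵏ]` is onto), hence bijective by counting
    have hgsurj : Function.Surjective g := by
      intro S
      obtain ⟨x, hx⟩ := proj_surjective_of_isAlgClosed_holds W ℓ k S.2
      refine ⟨(PadicInt.toZModPow k (b.repr x 0), PadicInt.toZModPow k (b.repr x 1)),
        Subtype.ext ?_⟩
      rw [hgcoe, ← hx, proj_eq_sum_repr W ℓ b x k]
    have hℓK' : ((ℓ ^ k : ℕ) : AlgebraicClosure K) ≠ 0 := by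
      rw [Nat.cast_pow, ne_eq, pow_eq_zero_iff hkpos.ne', ← map_natCast (algebraMap K _),
        map_eq_zero]
      exact hℓK
    have hcardE : Nat.card (geomTorsion W ((ℓ ^ k : ℕ) : ℤ)) = (ℓ ^ k) ^ 2 :=
      card_torsionPoints_eq_sq_holds W (AlgebraicClosure K) hℓK'
    have hcardZ : Nat.card (ZMod (ℓ ^ k) × ZMod (ℓ ^ k)) = (ℓ ^ k) ^ 2 := by
      rw [Nat.card_prod, Nat.card_zmod, sq]
    obtain ⟨eqv⟩ := Finite.card_eq.mp (hcardZ.trans hcardE.symm)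
    have hginj : Function.Injective g := (Finite.injective_iff_surjective_of_equiv eqv).mpr hgsurj
    -- the columns of the matrix of `w`, reduced mod `ℓᵏ`, versus `w • e j = c • e j`
    set M := LinearMap.toMatrix b b (W.galoisRepTate ℓ w) with hM
    have hcol : ∀ j, w • e j = g (PadicInt.toZModPow k (M 0 j), PadicInt.toZModPow k (M 1 j)) := by
      intro j
      apply Subtype.ext
      rw [hgcoe, AddSubgroup.torsionBy.coe_smul]
      show w • TateModule.proj ℓ k (b j) = _
      rw [← TateModule.proj_smul_of_distribMulAction, ← galoisRepTate_apply_apply,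
        proj_eq_sum_repr W ℓ b _ k, hM, LinearMap.toMatrix_apply, LinearMap.toMatrix_apply]
    have hc0 : w • e 0 = g ((c : ZMod (ℓ ^ k)), 0) := by
      rw [hc, hg]
      simp only [ZMod.val_zero, zero_smul, add_zero]
      rw [← natCast_zsmul, val_intCast_smul_geomTorsion]
    have hc1 : w • e 1 = g (0, (c : ZMod (ℓ ^ k))) := by
      rw [hc, hg]
      simp only [ZMod.val_zero, zero_smul, zero_add]
      rw [← natCast_zsmul, val_intCast_smul_geomTorsion]
    have h0 := hginj ((hcol 0).symm.trans hc0)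
    have h1' := hginj ((hcol 1).symm.trans hc1)
    rw [Prod.mk.injEq] at h0 h1'
    -- determinant
    have hdetM : M.det = 1 := by rw [hM, LinearMap.det_toMatrix]; exact hdet
    have hdetZ := congrArg (PadicInt.toZModPow k) hdetM
    rw [RingHom.map_det, map_one, Matrix.det_fin_two] at hdetZ
    simp only [RingHom.mapMatrix_apply, Matrix.map_apply] at hdetZ
    rw [h0.1, h0.2, h1'.1, h1'.2, mul_zero, sub_zero] at hdetZ
    rw [← ZMod.intCast_zmod_eq_zero_iff_dvd]
    push_cast
    rw [sq, hdetZ, sub_self]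
  -- (iii) `ℓᵏ` is coprime to `c + 1` (as `c ≡ 1 mod ℓ`, `ℓ` odd), so `ℓᵏ ∣ c - 1`
  have hprime : Prime (ℓ : ℤ) := Nat.prime_iff_prime_int.mp hℓ
  have hndvd : ¬ (ℓ : ℤ) ∣ c + 1 := fun h ↦ by
    have h2 : (ℓ : ℤ) ∣ 2 := by
      have := dvd_sub h hℓdvd
      rwa [show c + 1 - (c - 1) = (2 : ℤ) by ring] at this
    have hle : ℓ ≤ 2 := Nat.le_of_dvd two_pos (by exact_mod_cast h2)
    exact hℓ2 (le_antisymm hle hℓ.two_le)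
  have hcop : IsCoprime (((ℓ ^ k : ℕ) : ℤ)) (c + 1) := by
    rw [Nat.cast_pow]
    exact ((Prime.coprime_iff_not_dvd hprime).mpr hndvd).pow_left
  refine hcop.dvd_of_dvd_mul_right ?_
  rw [show (c - 1) * (c + 1) = c ^ 2 - 1 by ring]
  exact hsqdvd

/-- **Non-commuting `ℓ`-adic images inside `Gal(K̄/K(E[ℓⁿ]))` give a non-scalar commutator at some
finite level** (`ℓ` odd, `ℓ ≠ char K`, `n ≥ 1`).  If `σ, τ` act trivially on `E[ℓⁿ]` and
`ρ_ℓ(σ)ρ_ℓ(τ) ≠ ρ_ℓ(τ)ρ_ℓ(σ)` on `T_ℓ E`, then for some `m` the commutator `σ⁻¹τ⁻¹στ` does not act on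
`E[ℓᵐ]` as an integer: otherwise, having determinant `1` and acting trivially on `E[ℓ]`, it would
act trivially on every `E[ℓᵐ]` (`pow_dvd_sub_one_of_det_eq_one_of_forall_smul_eq`), i.e. trivially
on `T_ℓ E = lim E[ℓᵐ]`. [cite: Serre1968, IV.2.2] -/
theorem exists_commutator_not_scalar_of_galoisRepTate_mul_ne [W.IsElliptic] (hℓK : (ℓ : K) ≠ 0)
    (hℓ2 : ℓ ≠ 2) {n : ℕ} (hn : 1 ≤ n) {σ τ : absoluteGaloisGroup K}
    (hσ : galoisRepTorsion W ((ℓ ^ n : ℕ) : ℤ) σ = 1) (hτ : galoisRepTorsion W ((ℓ ^ n : ℕ) : ℤ) τ = 1)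
    (hne : W.galoisRepTate ℓ σ * W.galoisRepTate ℓ τ ≠ W.galoisRepTate ℓ τ * W.galoisRepTate ℓ σ) :
    ∃ m : ℕ, ¬ ∃ c : ℤ, ∀ P : geomTorsion W ((ℓ ^ m : ℕ) : ℤ), (σ⁻¹ * τ⁻¹ * σ * τ) • P = c • P := by
  by_contra hall
  push Not at hall
  apply hne
  set w := σ⁻¹ * τ⁻¹ * σ * τ with hw
  set ρ := W.galoisRepTate ℓ with hρ
  -- `det ρ(w) = 1`
  have hdet : LinearMap.det (ρ w : W.tateModule ℓ →ₗ[ℤ_[ℓ]] W.tateModule ℓ) = 1 := by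
    have hinv : ∀ γ : absoluteGaloisGroup K,
        LinearMap.det (ρ γ⁻¹ : W.tateModule ℓ →ₗ[ℤ_[ℓ]] W.tateModule ℓ) *
          LinearMap.det (ρ γ : W.tateModule ℓ →ₗ[ℤ_[ℓ]] W.tateModule ℓ) = 1 := fun γ ↦ by
      rw [← map_mul, ← map_mul, inv_mul_cancel, map_one, map_one]
    rw [hw, map_mul, map_mul, map_mul, map_mul, map_mul, map_mul]
    calc LinearMap.det (ρ σ⁻¹) * LinearMap.det (ρ τ⁻¹) * LinearMap.det (ρ σ) * LinearMap.det (ρ τ)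
        = (LinearMap.det (ρ σ⁻¹) * LinearMap.det (ρ σ)) *
            (LinearMap.det (ρ τ⁻¹) * LinearMap.det (ρ τ)) := by ring
      _ = 1 := by rw [hinv, hinv, one_mul]
  -- `w` acts trivially on `E[ℓ]`
  have h1dvd : ((ℓ ^ 1 : ℕ) : ℤ) ∣ ((ℓ ^ n : ℕ) : ℤ) := by exact_mod_cast pow_dvd_pow ℓ hn
  have hker1 : w ∈ (galoisRepTorsion W ((ℓ ^ 1 : ℕ) : ℤ)).ker := by
    have hσ1 := ker_galoisRepTorsion_anti W h1dvd (MonoidHom.mem_ker.mpr hσ)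
    have hτ1 := ker_galoisRepTorsion_anti W h1dvd (MonoidHom.mem_ker.mpr hτ)
    rw [hw]
    exact Subgroup.mul_mem _ (Subgroup.mul_mem _ (Subgroup.mul_mem _ (Subgroup.inv_mem _ hσ1)
      (Subgroup.inv_mem _ hτ1)) hσ1) hτ1
  have h1 : ∀ P : geomTorsion W ((ℓ ^ 1 : ℕ) : ℤ), w • P = P :=
    (galoisRepTorsion_eq_one_iff W _ w).mp (MonoidHom.mem_ker.mp hker1)
  -- hence trivially on every `E[ℓᵏ]`
  have htriv : ∀ (k : ℕ) (P : geomTorsion W ((ℓ ^ k : ℕ) : ℤ)), w • P = P := by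
    intro k P
    obtain ⟨c, hc⟩ := hall k
    have hdvd := pow_dvd_sub_one_of_det_eq_one_of_forall_smul_eq W ℓ hℓK hℓ2 hdet h1 hc
    obtain ⟨d, hd⟩ := hdvd
    have hN : (((ℓ ^ k : ℕ) : ℤ)) • P = 0 := by
      apply Subtype.ext
      rw [AddSubgroupClass.coe_zsmul, ZeroMemClass.coe_zero]
      exact (Submodule.mem_torsionBy_iff _ (P : geomPoints W)).mp P.2
    have hc' : c = 1 + d * (((ℓ ^ k : ℕ) : ℤ)) := by rw [mul_comm, ← hd]; ring
    rw [hc, hc', add_smul, one_smul, mul_smul, hN, smul_zero, add_zero]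
  -- so `ρ(w) = 1` on `T_ℓ E = lim E[ℓᵏ]`, and `ρ(σ), ρ(τ)` commute
  have hw1 : ρ w = 1 := by
    refine LinearMap.ext fun a ↦ TateModule.ext fun k ↦ ?_
    rw [hρ, galoisRepTate_apply_apply, TateModule.proj_smul_of_distribMulAction,
      Module.End.one_apply]
    have h := congrArg (fun Q : geomTorsion W ((ℓ ^ k : ℕ) : ℤ) ↦ (Q : geomPoints W))
      (htriv k ⟨_, proj_tateModule_mem_geomTorsion W ℓ k a⟩)
    simpa only [AddSubgroup.torsionBy.coe_smul] using h
  have hcomm : σ * τ = τ * σ * w := by rw [hw]; group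
  calc ρ σ * ρ τ = ρ (σ * τ) := (map_mul ρ σ τ).symm
    _ = ρ (τ * σ * w) := by rw [hcomm]
    _ = ρ τ * ρ σ := by rw [map_mul, map_mul, hw1, mul_one]

end AnyField

/-! ### Density `0` of the supersingular primes from a non-abelian `ℓ`-adic image -/

section Rat

variable (W : WeierstrassCurve ℚ) [W.IsElliptic] [W.IsGloballyMinimal]

/-- **Density `0` of the supersingular primes, granted that `ρ_{E,ℓ}(Gal(ℚ̄/ℚ(E[ℓⁿ])))` is
non-abelian for every `n`** (`ℓ` an odd prime): for an elliptic curve `E/ℚ` in global minimal form,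
if for every `n` there are `σ, τ` acting trivially on `E[ℓⁿ]` whose `ℓ`-adic images on `T_ℓ E` do
not commute, then the good supersingular primes of `E` have natural density `0` — part 10's
`hasPrimeDensity_goodSupersingularPrimes_zero_of_commutator_not_scalar` with
`exists_commutator_not_scalar_of_galoisRepTate_mul_ne` (at level `n + 1 ≥ 1`).  For a non-CM curve
the hypothesis is Serre 1968, IV.2.2 (`𝔤_ℓ = 𝔤𝔩₂`: no open subgroup of the image is abelian).
[cite: Serre1981, p. 123 (a) and §8 Thm. 20 Cor. 2] -/
theorem hasPrimeDensity_goodSupersingularPrimes_zero_of_galoisRepTate_mul_ne (ℓ : ℕ) [Fact ℓ.Prime]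
    (hℓ2 : ℓ ≠ 2)
    (hH : ∀ n : ℕ, ∃ σ τ : absoluteGaloisGroup ℚ,
      galoisRepTorsion W ((ℓ ^ n : ℕ) : ℤ) σ = 1 ∧ galoisRepTorsion W ((ℓ ^ n : ℕ) : ℤ) τ = 1 ∧
        W.galoisRepTate ℓ σ * W.galoisRepTate ℓ τ ≠ W.galoisRepTate ℓ τ * W.galoisRepTate ℓ σ) :
    HasPrimeDensity W.goodSupersingularPrimes 0 := by
  have hℓ : ℓ.Prime := Fact.out
  have hℓ0 : (ℓ : ℚ) ≠ 0 := by exact_mod_cast hℓ.ne_zero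
  refine hasPrimeDensity_goodSupersingularPrimes_zero_of_commutator_not_scalar W ℓ fun n ↦ ?_
  obtain ⟨σ, τ, hσ, hτ, hne⟩ := hH (n + 1)
  obtain ⟨m, hm⟩ := exists_commutator_not_scalar_of_galoisRepTate_mul_ne W ℓ hℓ0 hℓ2
    (Nat.le_add_left 1 n) hσ hτ hne
  have hdvd : ((ℓ ^ n : ℕ) : ℤ) ∣ ((ℓ ^ (n + 1) : ℕ) : ℤ) := by
    exact_mod_cast pow_dvd_pow ℓ (Nat.le_succ n)
  exact ⟨m, σ, τ,
    MonoidHom.mem_ker.mp (ker_galoisRepTorsion_anti W hdvd (MonoidHom.mem_ker.mpr hσ)),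
    MonoidHom.mem_ker.mp (ker_galoisRepTorsion_anti W hdvd (MonoidHom.mem_ker.mpr hτ)), hm⟩

/-- **Serre 1981, p. 123 (a) / §8 Thm. 20 Cor. 2 ⇐ Serre 1968, IV.2.2 in the form "for a non-CM
`E/ℚ` some odd `ℓ` has `ρ_{E,ℓ}(Gal(ℚ̄/ℚ(E[ℓⁿ])))` non-abelian for every `n`".**  Granted that
statement for every elliptic curve over `ℚ` in global minimal form without complex multiplication,
the named fact `serre_supersingular_density_zero` holds.  (The hypothesis follows from the residual
Faltings fact `Literature.AlgebraicGeometry.Motives.exists_eq_smul_one_of_equivariant_of_not_hasRationalCM`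
for the curves `E/ℚ(E[ℓⁿ])` together with the tree's irreducibility theorem
`finrank_ne_one_of_stable_of_not_hasRationalCM_of_isogenyClass`: an abelian `ρ_ℓ(Gal(ℚ̄/ℚ(E[ℓⁿ])))`
would lie in the commutant, which is `ℚ_ℓ`, making every line stable; and a fortiori from Serre's
open image theorem.) [cite: Serre1981, p. 123 (a) and §8 Thm. 20 Cor. 2] -/
theorem serre_supersingular_density_zero_of_galoisRepTate_mul_ne
    (hH : ∀ (W : WeierstrassCurve ℚ) [W.IsElliptic] [W.IsGloballyMinimal], ¬ W.HasCM →
      ∃ (ℓ : ℕ) (_ : Fact ℓ.Prime), ℓ ≠ 2 ∧ ∀ n : ℕ, ∃ σ τ : absoluteGaloisGroup ℚ,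
        galoisRepTorsion W ((ℓ ^ n : ℕ) : ℤ) σ = 1 ∧ galoisRepTorsion W ((ℓ ^ n : ℕ) : ℤ) τ = 1 ∧
          W.galoisRepTate ℓ σ * W.galoisRepTate ℓ τ ≠ W.galoisRepTate ℓ τ * W.galoisRepTate ℓ σ) :
    serre_supersingular_density_zero := by
  intro W _ _ hCM
  obtain ⟨ℓ, hℓ, hℓ2, h⟩ := hH W hCM
  exact hasPrimeDensity_goodSupersingularPrimes_zero_of_galoisRepTate_mul_ne W ℓ hℓ2 h

end Rat

end WeierstrassCurve
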